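import Summits.ValiantsHypothesis.ValiantsHypothesis.Theses.RealTau
import Summits.ValiantsHypothesis.ValiantsHypothesis.Theorems.RealTauRealVnTransferStubRealEngine
import Summits.ValiantsHypothesis.ValiantsHypothesis.Theorems.RealTauRealVnTransferStubRealLiftData

/-!
# Route RealTau — crux `RealVnTransfer` (stmt-ValiantsHypothesis-18102), line `realified-depth-four`

**Tavenas' with-constants transfer for `V_n`** (thesis 2014, Thm. 3.38 = Cor. 3.37 + Prop. 3.21 +
realification): if `PER` is p-computable over `ℂ` then for some `C` every
`V_n = ∑_{i<2^n} 2^{2i(2^n-1-i)} X^i` is, in `ℝ[X]`, a sum of `k ≤ (n+2)^{C(⌊√(2n+3)⌋+1)}` products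
of `m ≤ C(⌊√(2n+3)⌋+1)` polynomials with at most `(n+2)^{C(⌊√(2n+3)⌋+1)}` monomials each.

The registered skeleton `Cruxes/RealVnTransfer/Lines/realified_depth_four.lean`, sorry-free: its two
stubs are the landed theorems
`…Theorems.RealTauRealVnTransfer.stub_realLiftData` (Cor. 3.37 base-changed to `ℝ` with the
complexity bound `L_ℝ(H_n) ≤ (n+2)^e` under `PER ∈ VP_ℝ`) and
`…Theorems.RealTauRealVnTransfer.stub_realEngine` (Prop. 3.21 with constants over `ℝ` for
arbitrary families and term substitutions); the composition realifies the hypothesis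
(`SymmetroidDescartes.isPComputable_perPoly_real_of_complex`, Hrubeš–Yehudayoff Thm 4.2, item
18106) and runs the engine with `f_n = V_n`, `d = r = 2n+3 ≤ (n+2)²`, `v_n` = the substitution
(3.1) `x_j ↦ X^{2^j}`, `z_i ↦ 2^{2^i}` mapped along `ℚ → ℝ`.  The exponent shape of the route decl
comes out exactly (no restatement).

Unconditional (axioms `propext`, `Classical.choice`, `Quot.sound`). References: S. Tavenas, PhD
thesis, ENS Lyon 2014, Thm. 3.38, Cor. 3.37, Prop. 3.21, Lemme 3.36; P. Hrubeš, A. Yehudayoff,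
Arithmetic complexity in ring extensions, Theory Comput. 7 (2011), Thm 4.2.
-/

noncomputable section

-- single-conjunct layout: Sub = Summit, duplicated namespace component intended
set_option linter.dupNamespace false

namespace Summit.ValiantsHypothesis.ValiantsHypothesis.Theorems.RealTauRealVnTransfer

open MvPolynomial Literature.Computability.AlgebraicComplexity

/-- Every value of the realified substitution (3.1), `x_j ↦ X^{2^j}`, `z_i ↦ 2^{2^i}`, is a term
`c X^e`. [folklore] -/
theorem isTerm_map_kpSubst (d r : ℕ) (x : Fin d ⊕ Fin r) :
    IsTerm ((kpSubst d r x).map (algebraMap ℚ ℝ)) := by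
  rcases x with j | i
  · simp only [kpSubst, Sum.elim_inl, Polynomial.map_pow, Polynomial.map_X]
    exact isTerm_X_pow _
  · simp only [kpSubst, Sum.elim_inr, Polynomial.map_C]
    exact isTerm_C _

/-- **Item `RealVnTransfer` (stmt-ValiantsHypothesis-18102) holds** — Tavenas 2014, Thm. 3.38 with
constants, conclusion over `ℝ`: if `PER` is p-computable over `ℂ` then every `V_n` is a real
ΣΠ-sparse expression with `k, t ≤ (n+2)^{C(⌊√(2n+3)⌋+1)}`, `m ≤ C(⌊√(2n+3)⌋+1)`.  The line
`realified-depth-four` (LIFT DATA → ENGINE): realify the hypothesis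
(`isPComputable_perPoly_real_of_complex`, item 18106), take the lifted data (`stub_realLiftData`,
Cor. 3.37 ⊗ ℝ), and run the engine (`stub_realEngine`, Prop. 3.21 with constants over `ℝ`) with
`f_n = V_n`, `d = r = 2n + 3 ≤ (n+2)²` (`e₁ = 2`), `v_n` the realified substitution (3.1).
[cite: Tavenas2014, Thm. 3.38] -/
theorem realVnTransfer_proof :
    Summit.ValiantsHypothesis.ValiantsHypothesis.Theses.RealTau.RealVnTransfer := by
  intro hP
  -- realification (tree theorem, item 18106)
  have hR : IsPComputable (fun n => perPoly (Fin n) ℝ) :=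
    Summit.ValiantsHypothesis.ValiantsHypothesis.Theorems.SymmetroidDescartes.isPComputable_perPoly_real_of_complex
      hP
  -- the lifted data (Cor. 3.37 over `ℝ`)
  obtain ⟨e, He⟩ := stub_realLiftData hR
  -- the engine with `d = r = 2n + 3`, `e₁ = 2`
  have hd : ∀ n : ℕ, 2 * n + 3 ≤ (n + 2) ^ 2 := fun n => by rw [pow_two]; nlinarith
  obtain ⟨C, hC⟩ := stub_realEngine (fun n => (tavenasV n).map (Int.castRingHom ℝ))
    (fun n => 2 * n + 3) (fun n => 2 * n + 3) 2 e hd (fun n => le_rfl)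
    (fun n x => (kpSubst (2 * n + 3) (2 * n + 3) x).map (algebraMap ℚ ℝ))
    (fun n x => isTerm_map_kpSubst _ _ x) He
  exact ⟨C, hC⟩

end Summit.ValiantsHypothesis.ValiantsHypothesis.Theorems.RealTauRealVnTransfer

end
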